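import Summits.AnomalousDissipation.AnomalousDissipation.Theorems.QuasiStaticSolenoidalCellTensorQ.Negative.Iterate
import HarnessLib

/-!
# Negative side of K2Q `QuasiStaticSolenoidalCellTensorQ` (stmt-AnomalousDissipation-19072): the exponential floor of the
# principal pair of the cell truncation of an ARBITRARY isotropic word (Galerkin level; helper, `--supports 19072`)

Summits-side helper file (everything proved; no definitions, no named facts).  `galerkin_floor_cell` chains `window_step_tm`
over windows of `q` periods with `iterate_floor`, using `drain_value_le` for the isotropic value of the frozen drain and the
scalar bookkeeping `step_floor_algebra` / `step_cone_algebra`: under the numeric hypotheses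
`e^{−ΛQ/2} ≤ 1/4` (rest gap over a window, `Λ = 2κ4π²(n/2)²`, `Q = qP`), `4d ≤ q(1−4ρ/3)τ_min Λ η` (cone budget) and
`a ≤ 1/2`, and the initial cone `R(0) ≤ ηx(0)`, `x(0) > 0`, the principal pair energy of the Galerkin truncation satisfies
`x(t) ≥ x(0)(1−a)e^{−(a(1+2a)/Q)t}` for all `t ≥ 0`, with `a = η + 2κ4π²|ℓ|²(1+η)Q + d` and
`d = 4q(1−4ρ/3)F[(1+ε)(32π⁴c₀+3θ)/2 + (1+1/ε)E(1+η)Q²]`, `F = P|ℓ|²/(8π²κn⁴(1−θ)²)`, `θ = |ℓ|/n`,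
`E = e^{2κ4π²|ℓ|²Q}c_F²`: per unit time the leading part of `a/Q` is `2κ4π²|ℓ|²(1 + (1+ε)(1−4ρ/3)c₀·4π²... )`, i.e. the
realised Taylor rate `8π²|ℓ|²(ν/n²)(1 + (1+ε)(1−4ρ/3)c₀/ν²)` at `κ = ν/n²` — the factor `1 − 4ρ/3` for EVERY word.
No long-slot hypothesis.  This is NOT a proof of anomalous dissipation, and by itself not of `¬ K2Q`.
-/

set_option linter.dupNamespace false

noncomputable section

namespace Summit.AnomalousDissipation.AnomalousDissipation.Theorems.QuasiStaticSolenoidalCellTensorQ.Negative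

open Set MeasureTheory Filter Topology Function
open scoped InnerProductSpace ComplexConjugate BigOperators
open Literature.Analysis Literature.Analysis.FunctionSpaces Literature.Analysis.FunctionSpaces.Torus
open Literature.Analysis.FluidPDE Literature.Analysis.FluidPDE.LatticeShear
open Summit.AnomalousDissipation.AnomalousDissipation.Theorems.SolenoidalFractalHomogenisation.PermissibleCarrier
open Summit.AnomalousDissipation.AnomalousDissipation.Theorems.SolenoidalFractalHomogenisation.RealisedQuasiStaticCellLaw

variable {k₀ : ℕ}

/-- `(e·(c·√s)·Q)² = e²c²·s·Q²` for `s ≥ 0`. -/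
theorem sq_exp_mul_sqrt (e c s Q : ℝ) (hs : 0 ≤ s) : (e * (c * Real.sqrt s) * Q) ^ 2 = e ^ 2 * c ^ 2 * s * Q ^ 2 := by
  rw [mul_pow, mul_pow, mul_pow, Real.sq_sqrt hs]; ring

set_option maxHeartbeats 3200000 in
/-- **The exponential floor of the principal pair (Galerkin level), for an arbitrary isotropic word.**  See the module
docstring. -/
theorem galerkin_floor_cell (W : LatticeWord k₀) {c₀ : ℝ} (hW : IsotropicWordGain W c₀) {n : ℕ} (hn : 0 < n) {κ : ℝ}
    (hκ : 0 < κ) (ℓ : Fin 3 → ℤ) (hℓ : ℓ ≠ 0) (hℓn : 2 * ‖latticeVec ℓ‖ < n)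
    {w₀ : UnitAddTorus (Fin 3) → EuclideanSpace ℝ (Fin 3)}
    (hw₀ : FunctionSpaces.Torus.MemSobolev 1 (FunctionSpaces.EuclideanSpace.complexify ∘ w₀))
    (hdiv : FunctionSpaces.Torus.IsWeaklyDivFree w₀) (hmean : FunctionSpaces.Torus.HasZeroMean w₀)
    (hsupp : ∀ k : Fin 3 → ℤ, ¬ ((∃ z : Fin 3 → ℤ, k = ℓ + (n:ℤ) • z) ∨ (∃ z : Fin 3 → ℤ, k = -ℓ + (n:ℤ) • z)) →
      UnitAddTorus.mFourierCoeff (FunctionSpaces.EuclideanSpace.complexify ∘ w₀) k = 0)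
    {N : ℕ} (hBN : (Finset.univ.biUnion fun j : Fin k₀ =>
        ({(fun i => (W.phase j).m i * n), -(fun i => (W.phase j).m i * n)} : Finset (Fin 3 → ℤ))) ⊆ freqBall N)
    (hℓN : ℓ ∈ freqBall N)
    (hball : ∀ j : Fin k₀, ∀ k ∈ ({ℓ, -ℓ} : Finset (Fin 3 → ℤ)),
      k - (fun i => (W.phase j).m i * (n : ℤ)) ∈ freqBall N ∧ k + (fun i => (W.phase j).m i * (n : ℤ)) ∈ freqBall N)
    (q : ℕ) (hq : 0 < q) {ε η τm : ℝ} (hε : 0 < ε) (hη : 0 ≤ η) (hτm : 0 < τm) (hτ : ∀ j, τm ≤ (W.phase j).τ) :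
    let Q := (q : ℝ) * W.period
    let lam := 2 * (κ * (4 * Real.pi ^ 2 * freqNormSq ℓ))
    let Λ := 2 * (κ * (4 * Real.pi ^ 2 * ((n : ℝ) / 2) ^ 2))
    let θ := ‖latticeVec ℓ‖ / n
    let cF := ∑ j : Fin k₀, (1 / (n : ℝ)) * (2 * Real.pi * |∑ i, (W.phase j).e i * (ℓ i : ℝ)|) *
      (‖Complex.exp ((W.phase j).φ * Complex.I) * (1 / (2 * ((2 * Real.pi * ‖latticeVec (W.phase j).m‖ : ℝ) : ℂ) * Complex.I))‖ +
        ‖starRingEnd ℂ (Complex.exp ((W.phase j).φ * Complex.I)) *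
          (-(1 / (2 * ((2 * Real.pi * ‖latticeVec (W.phase j).m‖ : ℝ) : ℂ) * Complex.I)))‖)
    let F := W.period * freqNormSq ℓ / (8 * Real.pi ^ 2 * κ * (n : ℝ) ^ 4 * (1 - θ) ^ 2)
    let E := Real.exp (κ * (4 * Real.pi ^ 2 * freqNormSq ℓ) * Q) ^ 2 * cF ^ 2
    let qρ := (q : ℝ) * (1 - 4 * W.ramp / 3)
    let d := 4 * qρ * F * ((1 + ε) * (32 * Real.pi ^ 4 * c₀ + 3 * θ) / 2 + (1 + 1 / ε) * (E * (1 + η) * Q ^ 2))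
    let a := η + lam * (1 + η) * Q + d
    let x := fun t => ‖(pvSetup_cell W hn hκ.le ℓ hw₀ hdiv hmean hsupp).galerkinCoeffAt N t ℓ‖ ^ 2 +
      ‖(pvSetup_cell W hn hκ.le ℓ hw₀ hdiv hmean hsupp).galerkinCoeffAt N t (-ℓ)‖ ^ 2
    let R := fun t => ∑ k ∈ freqBall N \ {ℓ, -ℓ}, ‖(pvSetup_cell W hn hκ.le ℓ hw₀ hdiv hmean hsupp).galerkinCoeffAt N t k‖ ^ 2
    Real.exp (-(Λ / 2) * Q) ≤ 1 / 4 → 4 * d ≤ qρ * τm * Λ * η → a ≤ 1 / 2 → R 0 ≤ η * x 0 → 0 < x 0 →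
      ∀ t, 0 ≤ t → x 0 * (1 - a) * Real.exp (-(a * (1 + 2 * a) / Q) * t) ≤ x t := by
  intro Q lam Λ θ cF F E qρ d a x R hgap hbudget ha h0 hx0
  classical
  set hPV := pvSetup_cell W hn hκ.le ℓ hw₀ hdiv hmean hsupp with hPVdef
  -- positivity
  have hP : 0 < W.period := period_pos W
  have hn' : (0:ℝ) < n := by exact_mod_cast hn
  have hq' : (0:ℝ) < q := by exact_mod_cast hq
  have hQ : 0 < Q := mul_pos hq' hP
  have hρ : 0 < 1 - 4 * W.ramp / 3 := by have := W.ramp_le; linarith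
  have hqρ : 0 < qρ := mul_pos hq' hρ
  have hΛ : 0 < Λ := by positivity
  have hlam : 0 ≤ lam := mul_nonneg (by norm_num) (mul_nonneg hκ.le (mul_nonneg (by positivity) (freqNormSq_nonneg _)))
  have hθ0 : 0 ≤ θ := by positivity
  have hθ1 : θ < 1 / 2 := by show ‖latticeVec ℓ‖ / n < 1 / 2; rw [div_lt_iff₀ hn']; linarith
  have hF : 0 ≤ F := by
    have : 0 ≤ freqNormSq ℓ := freqNormSq_nonneg _
    have : 0 < 1 - θ := by linarith
    positivity
  have hE : 0 ≤ E := by positivity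
  -- `c₀ ≥ 0` from isotropy at the (non-zero, transversal) principal vector at time 0
  have hc₀ : 0 ≤ c₀ := by
    have hsym : ‖hPV.galerkinCoeffAt N 0 (-ℓ)‖ = ‖hPV.galerkinCoeffAt N 0 ℓ‖ := by
      rw [hPV.isConjSymm_galerkinCoeffAt N 0 ℓ, EuclideanSpace.norm_conjVec]
    have hv : 0 < ‖hPV.galerkinCoeffAt N 0 ℓ‖ ^ 2 := by
      have h : 0 < ‖hPV.galerkinCoeffAt N 0 ℓ‖ ^ 2 + ‖hPV.galerkinCoeffAt N 0 (-ℓ)‖ ^ 2 := hx0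
      rw [hsym] at h; linarith
    have h := isotropic_proj_sum W hW hℓ (hPV.galerkinCoeffAt N 0 ℓ) (hPV.sum_mul_galerkinCoeffAt N 0 ℓ)
    have hl : 0 ≤ ∑ j, (W.phase j).τ * (1 / (2 * (2 * Real.pi * ‖latticeVec (W.phase j).m‖) ^ 4)) *
        (∑ i, (W.phase j).e i * (ℓ i : ℝ)) ^ 2 * ‖Torus.leraySym (W.phase j).m (hPV.galerkinCoeffAt N 0 ℓ)‖ ^ 2 :=
      Finset.sum_nonneg fun j _ => by have := (W.phase j).τ_pos; positivity
    rw [h] at hl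
    have hf : 0 < freqNormSq ℓ := lt_of_lt_of_le one_pos (Torus.one_le_freqNormSq_of_ne_zero hℓ)
    have hpos : 0 < W.period * freqNormSq ℓ * ‖hPV.galerkinCoeffAt N 0 ℓ‖ ^ 2 := by positivity
    by_contra hneg
    push Not at hneg
    nlinarith
  have hd0 : 0 ≤ d := by positivity
  have ha0 : 0 ≤ a := by positivity
  refine iterate_floor (x := x) (R := R) hQ ha0 ha (fun m hc hp => ?_) h0 hx0
  -- one window of `q` periods starting at `p = m q`
  have hT : (((m * q : ℕ) : ℝ) + q) * W.period ≤ (((m * q : ℕ) : ℝ) + q) * W.period := le_rfl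
  obtain ⟨hwin, hrest⟩ := window_step_tm W hn hκ ℓ hℓ hℓn hw₀ hdiv hmean hsupp hBN hℓN hball (m * q) q hT hε hτm hτ
  have et₀ : ((m * q : ℕ) : ℝ) * W.period = (m : ℝ) * Q := by show _ = (m : ℝ) * ((q : ℝ) * W.period); push_cast; ring
  have et₁ : (((m * q : ℕ) : ℝ) + q) * W.period = ((m : ℝ) + 1) * Q := by
    show _ = ((m : ℝ) + 1) * ((q : ℝ) * W.period); push_cast; ring
  have eQ : ((m : ℝ) + 1) * Q - (m : ℝ) * Q = Q := by ring
  simp only [et₀, et₁, eQ] at hwin hrest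
  -- the frozen vector, the drift radius, the drain value
  set v₀ := hPV.galerkinCoeffAt N ((m : ℝ) * Q) ℓ with hv₀
  have hxm0 : 0 ≤ x ((m : ℝ) * Q) := by positivity
  have hRm0 : 0 ≤ R ((m : ℝ) * Q) := Finset.sum_nonneg fun k _ => sq_nonneg _
  have hxv : x ((m : ℝ) * Q) = 2 * ‖v₀‖ ^ 2 := by
    have hsym : ‖hPV.galerkinCoeffAt N ((m : ℝ) * Q) (-ℓ)‖ = ‖v₀‖ := by
      rw [hPV.isConjSymm_galerkinCoeffAt N _ ℓ, EuclideanSpace.norm_conjVec]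
    show ‖hPV.galerkinCoeffAt N ((m : ℝ) * Q) ℓ‖ ^ 2 + ‖hPV.galerkinCoeffAt N ((m : ℝ) * Q) (-ℓ)‖ ^ 2 = 2 * ‖v₀‖ ^ 2
    rw [hsym, hv₀]; ring
  set δ : ℝ := Real.exp (κ * (4 * Real.pi ^ 2 * freqNormSq ℓ) * Q) * (cF * Real.sqrt (x ((m : ℝ) * Q) + R ((m : ℝ) * Q))) * Q
    with hδ
  have hB0 : 0 ≤ (1 + 1 / ε) * δ ^ 2 := by positivity
  have hB : (1 + 1 / ε) * δ ^ 2 ≤ (1 + 1 / ε) * (E * (x ((m : ℝ) * Q) + R ((m : ℝ) * Q)) * Q ^ 2) := by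
    refine le_of_eq ?_
    rw [hδ, sq_exp_mul_sqrt _ _ _ _ (by positivity)]
  have hdrain := drain_value_le W hW hn hκ hℓ hℓn v₀ (hPV.sum_mul_galerkinCoeffAt N _ ℓ) hε.le hB0
  -- floor at every time of the window, and the cone at its end
  refine ⟨fun t ht => (step_floor_algebra hxv (hwin t ht) (by linarith [ht.2]) (by linarith [ht.1]) hdrain hB hc hxm0
    hlam hη hε hqρ.le hF hE rfl).1, ?_⟩
  have hend := step_floor_algebra hxv (hwin (((m : ℝ) + 1) * Q) ⟨by nlinarith, le_rfl⟩) (by linarith) (by nlinarith)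
    hdrain hB hc hxm0 hlam hη hε hqρ.le hF hE rfl
  exact step_cone_algebra hrest hend.2 hend.1 hc hxm0 hRm0 hη hgap hτm hΛ hqρ hbudget ha

end Summit.AnomalousDissipation.AnomalousDissipation.Theorems.QuasiStaticSolenoidalCellTensorQ.Negative

end
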